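import Summits.QuantumFields.YangMills.Theorems.BalabanUVNodesN08Alpha324aVolume

/-!
# Route «BalabanUVNodes», Track-A DAG node N08 = [Balaban1985UV3] — THE (α) CLAUSE: the Gaussian-structural DATA rows `hμ`, `hboxm`,
# `hbox`, `h324a` of (58) FROM ONE IDENTIFICATION «dμ_{C^{(k)}} is a centred Gaussian measure and χ is the ball event of (51)»
# (p. 261 L30–33, p. 268 (51), p. 270 (58)) + the in-edge b9's covariance bound

Cell `pub-ymgap`, seat `pub-ymgap-dag-n08-d` gen 3, file 3 (director-ym R134 row «CLASS-I in-edge conclusions at the (α) granularity of `RunAlpha` …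
discharge the species-OK interfaces»; census `HOME/pub-ymgap-dag-n08-b/N08-ALPHA-ROWS.md` 6a78a4e68c218d11 §1: rows `hμ, hboxm, hbox, hVm, hVB` =
«III-structural — true by construction for print's objects (normalised Gaussian; box = product of balls (51) p. 268); definitional once `𝔖 k` is
print's data», row `h324a` = «III + I (b9 covariance bound)»).  `bears_on: R4∕N08`; filed `--supports stmt-QuantumFields-19903 --as helper`.
THEOREMS ONLY (def-free, sorry-free, standard axioms); composes file 2 (`BalabanUVNodesN08Alpha324aVolume`) BY NAME.

THE IDENTIFICATION (what a NODE 00 pin of the expansion data `𝔖 k` to print's objects instantiates; a HYPOTHESIS here about the free data).  Print,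
p. 261 L30–33: «The last integral above has the form ∫dμχ exp V, where dμ is a Gaussian measure with a covariance …»; (51) p. 268: «χ =
Π_{b∈B(Λ_{k+1})} χ({|A(b)| < g_kp²(g_k)})», after «the transformation A → g_kA» (p. 261 L25) `{|A(b)| < p²(g_k)}`; (58) p. 270 «∫dμ_{C^{(k)}}(A) χ
exp[…]».  Typed: a measurable coordinate map `e : Fl → ℝⁿ` of the data's fluctuation space under which `μ_k` becomes Mathlib's
`multivariateGaussian 0 S_k` (`μ.map e = N(0, S_k)`), and for every history the box is the preimage of the ball event of the blocks `fib h b ⊂ Fin n`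
(`|fib h b| ≤ d(𝔤)`, the real components of `A(b)`, `b ∈ B(Λ_{k+1}(h))`) at radius `p²(g_k)` (`B10Eq47Volume.ballEvent`); the count `4n ≤ Ca·|T₁^{(k)}|`.
WHAT THIS FILE PROVES, for a step `k < K`, from that identification: `isProbabilityMeasure_of_gaussianFluct` (row `hμ`), `measurableSet_ballEvent` +
`measurableSet_box_of_gaussianFluct` (row `hboxm`), `box_real_eq_of_gaussianFluct` (file 2's mass identification `hId` DERIVED: `μ(box h) =
N(0,S_k)(ball event)`), and — adding the in-edge b9's diagonal covariance bound `S_{ii} ≤ σ²` ([5] (3.155)–(3.156)) and the proviso «`4d(𝔤)σ²(6+2κ₀) ≤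
b₀⁴`» ((7) «b₀ sufficiently large»; `…Alpha324aVolume.proviso324a_of_le`) — `hbox_of_gaussianFluct` (row `hbox`) and `h324a_of_gaussianFluct` (row `h324a`,
[B1] (3.24)(a)) by file 2; `gaussianRows_of_gaussianFluct` bundles the four rows as they stand in `UVStability3DInputs.StepAlpha` ∕ gen 0's `StepDataRows`.
HONEST FRAMING: count-neutral; NOT a discharge of N08.  The rows `hVm ∕ hVB` (the effective potential `𝒱_k` on the box) and every class-II row are untouched;
the identification and the covariance bound are hypotheses about the free data `𝔖 k`.  d = 3 lattice gauge theory on finite tori as printed; nothing about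
d = 4, the continuum, OS axioms, a mass gap or the Clay problem.
-/

noncomputable section

namespace Summit.QuantumFields.YangMills.Theorems.BalabanUVNodesN08AlphaGaussianFluct

open MeasureTheory ProbabilityTheory
open scoped BigOperators
open Literature.MathematicalPhysics.QuantumFieldTheory.Balaban1983to89
open Literature.MathematicalPhysics.QuantumFieldTheory.Balaban1983to89.B10 (pFun)
open Literature.MathematicalPhysics.QuantumFieldTheory.Balaban1983to89.B10Eq47Volume (ballEvent)
open Literature.MathematicalPhysics.QuantumFieldTheory.Balaban1985CMP102
open Literature.MathematicalPhysics.QuantumFieldTheory.Balaban1985CMP102.Setting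
open Summit.QuantumFields.Balaban3D.Carriers
open Summit.QuantumFields.Balaban3D.Proofs.Inputs
open Summit.QuantumFields.Balaban3D.Proofs.Primitives (AlphaConsts)
open Summit.QuantumFields.Balaban3D.Proofs.GroupModelLieC (lieC)
open Summit.QuantumFields.YangMills.Theorems.BalabanUVNodesN08Alpha324aVolume (h324a_of_gaussianPin hbox_of_gaussianPin)

variable {L : ℕ}

/-! ## §1 The ball event of (51) is measurable -/

/-- **THE SMALL-FIELD EVENT `∩_b {|A(b)| < r}` IS MEASURABLE** (finitely many blocks; each `x ↦ √(Σ_{i∈fib b} x_i²)` is continuous on `ℝⁿ`).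
[cite: Balaban1985UV3, (51) p.268] -/
theorem measurableSet_ballEvent {n m : ℕ} (fib : Fin m → Finset (Fin n)) (r : ℝ) :
    MeasurableSet (ballEvent fib r : Set (EuclideanSpace ℝ (Fin n))) := by
  have hrepr : (ballEvent fib r : Set (EuclideanSpace ℝ (Fin n))) =
      ⋂ b, {x : EuclideanSpace ℝ (Fin n) | Real.sqrt (∑ i ∈ fib b, x i ^ 2) < r} := by
    ext x; simp [ballEvent]
  rw [hrepr]
  refine MeasurableSet.iInter fun b => ?_
  refine (IsOpen.measurableSet (isOpen_lt ?_ continuous_const))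
  have hc : ∀ i : Fin n, Continuous fun x : EuclideanSpace ℝ (Fin n) => x i := fun i => (EuclideanSpace.proj i).continuous
  exact Real.continuous_sqrt.comp (continuous_finsetSum _ fun i _ => (hc i).pow 2)

/-! ## §2 The Gaussian-structural rows from ONE identification of (58)'s fluctuation measure -/

section Fluct

variable {S : Scales L} {G : Type} [GaugeGroup G] [MeasurableSpace G] [HaarData G] (𝔊 : GroupModel G) (𝔠 : AlphaConsts L 𝔊.N)
  (𝔖 : ∀ k, StepSeries S G ↥(lieC 𝔊) (nblkOf S 𝔠.lane.carrier k) k) (k : ℕ)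
  {n : ℕ} (Sm : Matrix (Fin n) (Fin n) ℝ) (e : (𝔖 k).Fl → EuclideanSpace ℝ (Fin n)) (he : Measurable e)
  (hμe : (𝔖 k).μ.map e = multivariateGaussian 0 Sm)
  (m : Hist S.P (k + 1) → ℕ) (fib : (h : Hist S.P (k + 1)) → Fin (m h) → Finset (Fin n))
  (hboxe : ∀ h, (𝔖 k).box h = e ⁻¹' ballEvent (fib h) (pFun 𝔠.b₀ 𝔠.p₀ (S.gk k) ^ 2))

include he hμe in
/-- **ROW `hμ`**: the data's fluctuation measure is a probability measure (its image under the coordinate map is `N(0, S_k)`).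
[cite: Balaban1985UV3, (58) p.270 + p.261 L30–33] -/
theorem isProbabilityMeasure_of_gaussianFluct : IsProbabilityMeasure (𝔖 k).μ := by
  refine ⟨?_⟩
  have h := Measure.map_apply (μ := (𝔖 k).μ) he (MeasurableSet.univ : MeasurableSet (Set.univ : Set (EuclideanSpace ℝ (Fin n))))
  rw [Set.preimage_univ, hμe, measure_univ] at h
  exact h.symm

include he hboxe in
/-- **ROW `hboxm`**: the small-field box of every history is measurable (preimage of the ball event of (51)). [cite: Balaban1985UV3, (51) p.268] -/
theorem measurableSet_box_of_gaussianFluct (h : Hist S.P (k + 1)) : MeasurableSet ((𝔖 k).box h) := by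
  rw [hboxe h]
  exact he (measurableSet_ballEvent (fib h) _)

include he hμe hboxe in
/-- **FILE 2's MASS IDENTIFICATION, DERIVED**: `μ_k(box_k(h)) = N(0, S_k)(∩_b {|A(b)| < p²(g_k)})`. [cite: Balaban1985UV3, (51) p.268 + (58) p.270] -/
theorem box_real_eq_of_gaussianFluct (h : Hist S.P (k + 1)) :
    (𝔖 k).μ.real ((𝔖 k).box h) = (multivariateGaussian 0 Sm).real (ballEvent (fib h) (pFun 𝔠.b₀ 𝔠.p₀ (S.gk k) ^ 2)) := by
  rw [measureReal_def, measureReal_def, hboxe h, ← hμe, Measure.map_apply he (measurableSet_ballEvent (fib h) _)]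

variable (hk : k + 1 ≤ S.K) {σ2 : ℝ} (hσ : 0 < σ2) {dG : ℕ} (hdG : 0 < dG)
  (hprov : 4 * (dG : ℝ) * σ2 * (6 + 2 * 𝔠.κ₀) ≤ 𝔠.b₀ ^ 4)
  (hpsd : Sm.PosSemidef) (hfib : ∀ h b, (fib h b).card ≤ dG) (hcount : 4 * (n : ℝ) ≤ 𝔠.Ca * S.sites k) (hcov : ∀ i, Sm i i ≤ σ2)

include he hμe hboxe hk hσ hdG hprov hpsd hfib hcount hcov in
/-- **ROW `h324a` ([B1] (3.24)(a)) FROM THE IDENTIFICATION + b9's COVARIANCE BOUND** (file 2's `h324a_of_gaussianPin` with its mass identification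
supplied by `box_real_eq_of_gaussianFluct`). [cite: Balaban1985UV3, (51) p.268 + (47) p.267; Balaban1982Higgs1, (3.24) p.616] -/
theorem h324a_of_gaussianFluct :
    ∀ (h : Hist S.P (k + 1)) (U : GaugeField S.P (k + 1) G),
      |Real.log ((𝔖 k).μ.real ((𝔖 k).box h))| ≤ 𝔠.Ca * ((L : ℝ) ^ k * S.g0sq) ^ (3 + 𝔠.κ₀) * S.sites k :=
  h324a_of_gaussianPin 𝔊 𝔠 𝔖 k hk hσ hdG hprov (fun _ => n) (fun _ => Sm) m fib (fun _ => hpsd) hfib (fun _ => hcount)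
    (fun _ => hcov) (box_real_eq_of_gaussianFluct 𝔊 𝔠 𝔖 k Sm e he hμe m fib hboxe)

include he hμe hboxe hk hσ hdG hprov hpsd hfib hcov in
/-- **ROW `hbox`**: the box of every history has positive mass. [cite: Balaban1985UV3, (51) p.268 + (58) p.270] -/
theorem hbox_of_gaussianFluct : ∀ h : Hist S.P (k + 1), (𝔖 k).μ ((𝔖 k).box h) ≠ 0 :=
  hbox_of_gaussianPin 𝔊 𝔠 𝔖 k hk hσ hdG hprov (fun _ => n) (fun _ => Sm) m fib (fun _ => hpsd) hfib (fun _ => hcov)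
    (box_real_eq_of_gaussianFluct 𝔊 𝔠 𝔖 k Sm e he hμe m fib hboxe)

include he hμe hboxe hk hσ hdG hprov hpsd hfib hcount hcov in
/-- **THE FOUR GAUSSIAN-STRUCTURAL ROWS OF `StepAlpha k` ∕ `StepDataRows k` AT ONCE** — `hμ`, `hboxm`, `hbox`, `h324a` as they stand in the (α)
clause, from the one identification of (58)'s fluctuation measure, the count, b9's covariance bound and the proviso.  What the DATA schema keeps
of (58) after this file: the effective potential's rows `hVm ∕ hVB` and the cumulant remainder `h324c` ((3.24)(c), class II).
[cite: Balaban1985UV3, (58) p.270 + (51) p.268; Balaban1982Higgs1, (3.24) p.616] -/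
theorem gaussianRows_of_gaussianFluct :
    IsProbabilityMeasure (𝔖 k).μ ∧ (∀ h, MeasurableSet ((𝔖 k).box h)) ∧ (∀ h, (𝔖 k).μ ((𝔖 k).box h) ≠ 0) ∧
      ∀ (h : Hist S.P (k + 1)) (U : GaugeField S.P (k + 1) G),
        |Real.log ((𝔖 k).μ.real ((𝔖 k).box h))| ≤ 𝔠.Ca * ((L : ℝ) ^ k * S.g0sq) ^ (3 + 𝔠.κ₀) * S.sites k :=
  ⟨isProbabilityMeasure_of_gaussianFluct 𝔊 𝔠 𝔖 k Sm e he hμe,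
    measurableSet_box_of_gaussianFluct 𝔊 𝔠 𝔖 k e he m fib hboxe,
    hbox_of_gaussianFluct 𝔊 𝔠 𝔖 k Sm e he hμe m fib hboxe hk hσ hdG hprov hpsd hfib hcov,
    h324a_of_gaussianFluct 𝔊 𝔠 𝔖 k Sm e he hμe m fib hboxe hk hσ hdG hprov hpsd hfib hcount hcov⟩

end Fluct

end Summit.QuantumFields.YangMills.Theorems.BalabanUVNodesN08AlphaGaussianFluct

end
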